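import Summits.CriticalPhenomena.PercolationContinuityZ3.Theorems.PercAnnulusCrossingIICRootDegreeMaster
import HarnessLib

/-!
# The root of Kesten's IIC is a cut vertex with positive probability: `ν(0 screens some neighbour) ≥ (1−p)^{2d−1}/(2d)` (lane RSW3, p1 gen 12)

builds on p205010 (kernel theorem, internal audit signed; external expert review pending) — only in the `criticalProbI` corollary (`θ(p_c) = 0`).

RSW3 lane (LANE 3 `prim-rsw3`), seat `prim-rsw3-p1` (gen 12); memo `run/shared/lean/prim/rsw3/P1-QM.md` §25 (closing §24.4 agenda item (b)).
Helper file for the crux `stmt-CriticalPhenomena-4575` chain; no definitions, no sorries.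

p1 gen 11 (`…IICRootDegreeMaster`, `iicMeasure_le_tsum_screens`): under `θ(p) = 0` + (A2)□ the MEAN number of neighbours screened by the root
(`0 screens y`: `y` is an open neighbour of `0` whose cluster in `ω ∖ E(0)` is finite — `0` is a cut vertex separating `y`'s bush from infinity) is
`Σ_y ν(0 screens y) ≥ (1−p)^{2d−1}`.  Only the `2d` lattice neighbours contribute (`ν`-a.s. `ω ⊆ E(ℤ^d)`), so:

* `tsum_measure_screens_le` — `Σ_y ν(0 screens y) ≤ 2d · ν(0 screens some neighbour)`;
* **`iicMeasure_le_real_rootCutVertex`** — **`ν(∃ y, 0 screens y) ≥ (1−p)^{2d−1}/(2d) > 0`**: THE ROOT OF THE IIC CARRIES A FINITE PENDANT BUSH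
  (is a cut vertex of its cluster, separating an open neighbour from infinity) WITH POSITIVE PROBABILITY (every IIC measure at `p` with
  `θ(p) = 0`, (A2)□ `(s,L)`, `2 ≤ s`, `0 < p`, `d ≥ 1`); `…_criticalProbI` (at `p_c(ℤ^d)`, `d ≥ 2`), `…_Z2` (unconditional: `≥ 1/32`).
References: D. Aldous, R. Lyons, EJP 12 (2007) §2 (MTP); H. Kesten, PTRF 73 (1986) Thm. (3); D. Basu, A. Sapozhnikov, ECP 22 (2017) no. 26, Thm 1.1.
-/

noncomputable section

namespace Summit.CriticalPhenomena.PercolationContinuityZ3.Theorems.Crossing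

open MeasureTheory ProbabilityTheory Filter Topology
open Literature.Probability.Percolation Literature.Probability.LatticeModels
open Literature.Probability.Percolation.DCT16
open scoped ENNReal ProbabilityTheory

variable {d : ℕ}

/-- **Only lattice neighbours are screened**: for a measure `ν` carried by lattice configurations,
`Σ_y ν(0 screens y) ≤ 2d · ν(0 screens some y)` (the summand vanishes off the `2d` neighbours of `0`, and each term is at most the measure of
the union). [folklore] -/
theorem tsum_measure_screens_le {ν : Measure (BondConfig (Site d))} [IsFiniteMeasure ν]
    (hνE : ∀ᵐ ω ∂ν, ω ⊆ (zdGraph d).edgeSet) :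
    ∑' y : Site d, ν {ω | (openGraph ω).Adj 0 y ∧ ω \ {e : Sym2 (Site d) | (0 : Site d) ∈ e} ∉ percolatesAt y} ≤
      (2 * d : ℝ≥0∞) * ν (⋃ y : Site d, {ω | (openGraph ω).Adj 0 y ∧ ω \ {e : Sym2 (Site d) | (0 : Site d) ∈ e} ∉ percolatesAt y}) := by
  classical
  set S : Site d → Set (BondConfig (Site d)) := fun y =>
    {ω | (openGraph ω).Adj 0 y ∧ ω \ {e : Sym2 (Site d) | (0 : Site d) ∈ e} ∉ percolatesAt y} with hS
  -- off the lattice neighbours the summand is `ν`-null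
  have hzero : ∀ y ∉ (zdGraph d).neighborFinset 0, ν (S y) = 0 := by
    intro y hy
    refine measure_mono_null (fun ω hω => ?_) (ae_iff.1 hνE)
    intro hωE
    exact hy ((SimpleGraph.mem_neighborFinset _ _ _).2 (adj_of_openGraph_adj hωE hω.1))
  rw [tsum_eq_sum (s := (zdGraph d).neighborFinset 0) (fun y hy => hzero y hy)]
  calc ∑ y ∈ (zdGraph d).neighborFinset 0, ν (S y)
      ≤ ∑ _y ∈ (zdGraph d).neighborFinset 0, ν (⋃ y : Site d, S y) :=
        Finset.sum_le_sum fun y _ => measure_mono (Set.subset_iUnion S y)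
    _ = (2 * d : ℝ≥0∞) * ν (⋃ y : Site d, S y) := by
        rw [Finset.sum_const, card_neighborFinset_zdGraph_holds, nsmul_eq_mul]
        push_cast
        ring

/-- **THE ROOT OF KESTEN'S IIC IS A CUT VERTEX WITH POSITIVE PROBABILITY: `ν(0 screens some neighbour) ≥ (1−p)^{2d−1}/(2d)`** — with
`ν`-probability at least `(1−p)^{2d−1}/(2d)` some open neighbour `y` of the root has a FINITE cluster once the root's edges are closed (the root
separates `y`'s pendant bush from infinity).  Every IIC measure at `p` (`d ≥ 1`, `0 < p`) with `θ(p) = 0` and (A2)□ at aspect `(s,L)`, `2 ≤ s`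
(unimodularity: gen 11's screening transport `Σ_y ν(0 screens y) = Σ_y ν(y screens 0) ≥ (1−p)^{2d−1}`).
[cite: AldousLyons2007, §2 (MTP)] [cite: Kesten1986, Thm. (3)] [cite: BasuSapozhnikov2017ECP, Thm. 1.1] -/
theorem iicMeasure_le_real_rootCutVertex (hd : 1 ≤ d) (p : unitInterval) (hp : 0 < (p : ℝ)) (hθ : theta (zdGraph d) 0 p = 0)
    {s L : ℕ} (hs : 2 ≤ s) {ϰ : ℝ} (hϰ : 0 < ϰ) (hA2 : SetToSetQuasiMultAspectAt d p s L ϰ)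
    {ν : Measure (BondConfig (Site d))} [IsProbabilityMeasure ν]
    (hν : ∀ (F : Finset (Sym2 (Site d))) (E : Set (BondConfig (Site d))), MeasurableSet E → DeterminedBy E ↑F →
      Tendsto (fun n : ℕ => (bondPercolation (zdGraph d) p).real (E ∩ siteToBoundary d n) / oneArmProb d p n)
        atTop (𝓝 (ν.real E))) :
    (1 - (p : ℝ)) ^ (2 * d - 1) / (2 * d) ≤
      ν.real (⋃ y : Site d, {ω | (openGraph ω).Adj 0 y ∧ ω \ {e : Sym2 (Site d) | (0 : Site d) ∈ e} ∉ percolatesAt y}) := by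
  have hd1 : (1 : ℝ) ≤ d := by exact_mod_cast hd
  have hd0 : (0 : ℝ) < 2 * d := by linarith
  have h1 := iicMeasure_le_tsum_screens hd p hp hθ hs hϰ hA2 hν
  have h2 := tsum_measure_screens_le (ν := ν) (iicMeasure_ae_subset_edgeSet p hν)
  have h := h1.trans h2
  -- pass to reals
  rw [div_le_iff₀ hd0, measureReal_def]
  have hfin : (2 * d : ℝ≥0∞) * ν (⋃ y : Site d, {ω | (openGraph ω).Adj 0 y ∧ ω \ {e : Sym2 (Site d) | (0 : Site d) ∈ e} ∉ percolatesAt y}) ≠ ∞ :=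
    ENNReal.mul_ne_top (ENNReal.mul_ne_top (by norm_num) (ENNReal.natCast_ne_top d)) (measure_ne_top _ _)
  have h' := ENNReal.toReal_mono hfin h
  rw [ENNReal.toReal_ofReal (pow_nonneg (sub_nonneg.2 p.2.2) _), ENNReal.toReal_mul] at h'
  have hcast : ((2 * d : ℝ≥0∞)).toReal = 2 * (d : ℝ) := by simp
  rw [hcast] at h'
  linarith

/-- **The root of the IIC is a cut vertex with positive probability, at `p_c(ℤ^d)`** (`d ≥ 2`, (A2)□ at aspect `(s,L)`, `2 ≤ s`, `ϰ > 0`; every IIC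
measure): `ν(0 screens some neighbour) ≥ (1 − p_c)^{2d−1}/(2d) > 0`. [cite: AldousLyons2007, §2 (MTP)] [cite: BasuSapozhnikov2017ECP, Thm. 1.1] -/
theorem iicMeasure_le_real_rootCutVertex_criticalProbI (hd : 2 ≤ d) {s L : ℕ} (hs : 2 ≤ s) {ϰ : ℝ} (hϰ : 0 < ϰ)
    (hA2 : SetToSetQuasiMultAspectAt d (criticalProbI d) s L ϰ) {ν : Measure (BondConfig (Site d))} [IsProbabilityMeasure ν]
    (hν : ∀ (F : Finset (Sym2 (Site d))) (E : Set (BondConfig (Site d))), MeasurableSet E → DeterminedBy E ↑F →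
      Tendsto (fun n : ℕ => (bondPercolation (zdGraph d) (criticalProbI d)).real (E ∩ siteToBoundary d n) /
        oneArmProb d (criticalProbI d) n) atTop (𝓝 (ν.real E))) :
    0 < ν.real (⋃ y : Site d, {ω | (openGraph ω).Adj 0 y ∧ ω \ {e : Sym2 (Site d) | (0 : Site d) ∈ e} ∉ percolatesAt y}) := by
  have hpc0 : 0 < ((criticalProbI d : unitInterval) : ℝ) := by rw [coe_criticalProbI]; exact criticalProb_zd_pos d (by omega)
  have hpc1 : ((criticalProbI d : unitInterval) : ℝ) < 1 := by rw [coe_criticalProbI]; exact criticalProb_zd_lt_one hd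
  have h := iicMeasure_le_real_rootCutVertex (by omega) (criticalProbI d) hpc0 (CSH.percolationContinuity_allDimensions d hd) hs hϰ hA2 hν
  refine lt_of_lt_of_le ?_ h
  have hd1 : (1 : ℝ) ≤ d := by exact_mod_cast (show 1 ≤ d by omega)
  have hd0 : (0 : ℝ) < 2 * d := by linarith
  exact div_pos (pow_pos (by linarith) _) hd0

end Summit.CriticalPhenomena.PercolationContinuityZ3.Theorems.Crossing

end
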